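import Mathlib
import Literature.Analysis.InnerProduct.CourantFischerBounds
import Literature.Analysis.Matrix.ABvsBAEigenvalues

/-!
# Venture YMGap, track Y3 FLOW-DATA — the K-WEIGHT TAIL THEOREM of lineage B (flow-ref FR-18 / TAIL-A), typed

HONEST FRAMING: venture file of the cell `pub-ymgap` (QuantumFields programme), track Y3.  Lineage B (flow-eng-2,
engine «kstm») certifies eigenvalues of the SU(2) Wilson transfer matrix in the Kogut–Susskind spin-network basis,
`S = K^{1/2} V K^{1/2}` (`K` = diagonal link-weight kernel `∏_l a_{j_l}(β) ≥ 0`, `V` = the positive multiplication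
operator by `∏_p w(U_p)` compressed to the gauge-invariant space), from a KEPT SET `T = {K ≥ κ}` only: it computes
`S_T = K_T^{1/2} V K_T^{1/2}` and uses the tail theorem (bus 2026-08-22T19:27:44Z, countersigned by the referee as
FR-18 = flow-theory's TAIL-A v1.1)

  `λ↓_k(S_T) ≤ λ↓_k(S) ≤ λ↓_k(S_T) + κ_T · Ω`,  `κ_T = max_{i ∉ T} K_i`,  `Ω ≥ sup` of the quadratic form of `V`.

This file is that theorem as pure finite-dimensional linear algebra over `ℝ`, for an arbitrary positive semidefinite
`V`, arbitrary non-negative weights `K`, an arbitrary kept predicate `p` and any `κ` dominating the dropped weights: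
`eigenvalues₀_compressed_le` (lower) and `eigenvalues₀_le_compressed_add` (upper), for EVERY index `k` of Mathlib's
antitone enumeration `Matrix.IsHermitian.eigenvalues₀` (the compressed matrix is kept `n × n`, i.e. padded with the
zero block off the kept set — the certified blocks of the engine are its non-zero part).  PROOF (the referee's):
`S_T = X Xᵀ` and `M_T := Xᵀ X = V^{1/2} K_T V^{1/2}` with `X = K_T^{1/2} V^{1/2}` have the same sorted spectrum
(tree `ABvsBAEigenvalues.paddedEigenvalues_conjTranspose_mul_self`); `M = M_T + V^{1/2} K_⊥ V^{1/2}` with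
`0 ≤ ⟨x, V^{1/2} K_⊥ V^{1/2} x⟩ ≤ κ ⟨x, V x⟩ ≤ κ Ω ‖x‖²`, and the two one-sided Weyl inequalities of the tree's
`CourantFischerBounds`.  Finite real matrices only; no lattice object, no number, no row, nothing about limits or a
mass gap.  The floating-point part of a row (the certified radius of the computed `λ↓_k(S_T)`) is NOT covered here.

References: R. A. Horn, C. R. Johnson, *Matrix Analysis*, 2nd ed. (2013), Thm. 1.3.22 and Thm. 4.3.1
[cite: HornJohnson2013, Thm 1.3.22; Thm 4.3.1]; the cell's FLOW-REFEREE.md FR-18 (2026-08-22).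
-/

noncomputable section

open scoped MatrixOrder InnerProductSpace
open Matrix

namespace Summit.Ventures.YMGap.FlowData

namespace KWeightTail

variable {n : Type*} [Fintype n] [DecidableEq n]

/-! ### The matrices -/

/-- `S` is the compression to the trivial kept set «everything». [folklore] -/
theorem full_eq_compressed (V : Matrix n n ℝ) (K : n → ℝ) :
    (diagonal (fun i => Real.sqrt (K i)) * V * diagonal (fun i => Real.sqrt (K i))) = ((diagonal fun i => if (fun _ : n => True) i then Real.sqrt (K i) else (0 : ℝ)) * V * (diagonal fun i => if (fun _ : n => True) i then Real.sqrt (K i) else (0 : ℝ))) := by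
  simp

omit [Fintype n] in
/-- `K_T^{1/2}` is symmetric. [folklore] -/
theorem isHermitian_sqrtDiag (K : n → ℝ) (p : n → Prop) [DecidablePred p] : ((diagonal fun i => if p i then Real.sqrt (K i) else (0 : ℝ))).IsHermitian := by
  exact isHermitian_diagonal_of_self_adjoint _ (IsSelfAdjoint.all _)

/-- `S_T` is symmetric when `V` is. [folklore] -/
theorem isHermitian_compressed {V : Matrix n n ℝ} (hV : V.IsHermitian) (K : n → ℝ) (p : n → Prop)
    [DecidablePred p] : (((diagonal fun i => if p i then Real.sqrt (K i) else (0 : ℝ)) * V * (diagonal fun i => if p i then Real.sqrt (K i) else (0 : ℝ)))).IsHermitian := by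
  have h := isHermitian_conjTranspose_mul_mul ((diagonal fun i => if p i then Real.sqrt (K i) else (0 : ℝ))) hV
  rwa [(isHermitian_sqrtDiag K p).eq] at h

/-- `S` is symmetric when `V` is. [folklore] -/
theorem isHermitian_full {V : Matrix n n ℝ} (hV : V.IsHermitian) (K : n → ℝ) : ((diagonal (fun i => Real.sqrt (K i)) * V * diagonal (fun i => Real.sqrt (K i)))).IsHermitian := by
  rw [full_eq_compressed]; exact isHermitian_compressed hV K _

/-- `K_T^{1/2} K_T^{1/2} = K_T` for non-negative weights. [folklore] -/
theorem sqrtDiag_mul_sqrtDiag {K : n → ℝ} (hK : ∀ i, 0 ≤ K i) (p : n → Prop) [DecidablePred p] :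
    (diagonal fun i => if p i then Real.sqrt (K i) else (0 : ℝ)) * (diagonal fun i => if p i then Real.sqrt (K i) else (0 : ℝ)) = diagonal (fun i => if p i then K i else (0 : ℝ)) := by
  rw [diagonal_mul_diagonal]
  congr 1
  funext i
  split_ifs with h
  · exact Real.mul_self_sqrt (hK i)
  · simp

/-- Sorted eigenvalues depend on the matrix only (congruence along an equality of matrices). [folklore] -/
theorem eigenvalues₀_congr {A B : Matrix n n ℝ} (hAB : A = B) (hA : A.IsHermitian) (hB : B.IsHermitian) :
    hA.eigenvalues₀ = hB.eigenvalues₀ := by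
  subst hAB; rfl

/-! ### The square root of `V` and the factorisation `S_T = X Xᵀ`, `M_T = Xᵀ X` -/

section Root

variable {V : Matrix n n ℝ}

/-- `V^{1/2}` (Mathlib's C⋆-algebraic square root `CFC.sqrt` in the Loewner order) is symmetric. [folklore] -/
theorem isHermitian_root : (CFC.sqrt V).IsHermitian :=
  (CFC.sqrt_nonneg V).isSelfAdjoint

/-- `(V^{1/2})ᴴ = V^{1/2}`. [folklore] -/
theorem root_conjTranspose : (CFC.sqrt V)ᴴ = CFC.sqrt V := (isHermitian_root (V := V)).eq

/-- `(V^{1/2})ᵀ = V^{1/2}` (real matrices). [folklore] -/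
theorem root_transpose : (CFC.sqrt V)ᵀ = CFC.sqrt V := by
  have h := root_conjTranspose (V := V)
  rwa [conjTranspose_eq_transpose_of_trivial] at h

/-- `V^{1/2} V^{1/2} = V` for positive semidefinite `V`. [folklore] -/
theorem root_mul_root (hV : V.PosSemidef) : CFC.sqrt V * CFC.sqrt V = V :=
  CFC.sqrt_mul_sqrt_self V (Matrix.nonneg_iff_posSemidef.mpr hV)

variable (hV : V.PosSemidef) (K : n → ℝ) (p : n → Prop) [DecidablePred p]

include hV in
/-- `S_T = X_T X_Tᵀ` with `X_T = K_T^{1/2} V^{1/2}`. [folklore] -/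
theorem compressed_eq_xmat_mul : ((diagonal fun i => if p i then Real.sqrt (K i) else (0 : ℝ)) * V * (diagonal fun i => if p i then Real.sqrt (K i) else (0 : ℝ))) = ((diagonal fun i => if p i then Real.sqrt (K i) else (0 : ℝ)) * (CFC.sqrt V)) * (((diagonal fun i => if p i then Real.sqrt (K i) else (0 : ℝ)) * (CFC.sqrt V)))ᴴ := by
  rw [conjTranspose_mul, root_conjTranspose, (isHermitian_sqrtDiag K p).eq]
  have h : (diagonal fun i => if p i then Real.sqrt (K i) else (0 : ℝ)) * V * (diagonal fun i => if p i then Real.sqrt (K i) else (0 : ℝ)) = (diagonal fun i => if p i then Real.sqrt (K i) else (0 : ℝ)) * ((CFC.sqrt V) * (CFC.sqrt V)) * (diagonal fun i => if p i then Real.sqrt (K i) else (0 : ℝ)) := by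
    rw [root_mul_root hV]
  rw [h]
  simp only [Matrix.mul_assoc]

/-- `M_T := V^{1/2} K_T V^{1/2} = X_Tᵀ X_T` (for `K ≥ 0`). [folklore] -/
theorem mmat_eq_xmat_mul (hK : ∀ i, 0 ≤ K i) : ((CFC.sqrt V) * diagonal (fun i => if p i then K i else (0 : ℝ)) * (CFC.sqrt V)) = (((diagonal fun i => if p i then Real.sqrt (K i) else (0 : ℝ)) * (CFC.sqrt V)))ᴴ * ((diagonal fun i => if p i then Real.sqrt (K i) else (0 : ℝ)) * (CFC.sqrt V)) := by
  rw [conjTranspose_mul, root_conjTranspose, (isHermitian_sqrtDiag K p).eq, ← sqrtDiag_mul_sqrtDiag hK p]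
  simp only [Matrix.mul_assoc]

/-- `M_T` is symmetric. [folklore] -/
theorem isHermitian_mmat : (((CFC.sqrt V) * diagonal (fun i => if p i then K i else (0 : ℝ)) * (CFC.sqrt V))).IsHermitian := by
  have h := isHermitian_conjTranspose_mul_mul ((CFC.sqrt V))
    (isHermitian_diagonal_of_self_adjoint ((fun i => if p i then K i else (0 : ℝ))) (IsSelfAdjoint.all _))
  rwa [root_conjTranspose] at h

/-- `S_T` and `M_T` have the same sorted eigenvalues (Horn–Johnson Thm. 1.3.22 for `X_T X_Tᵀ` vs `X_Tᵀ X_T`).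
[cite: HornJohnson2013, Thm 1.3.22] -/
theorem eigenvalues₀_compressed_eq_mmat (hK : ∀ i, 0 ≤ K i) (k : Fin (Fintype.card n)) :
    (isHermitian_compressed hV.isHermitian K p).eigenvalues₀ k = (isHermitian_mmat (V := V) K p).eigenvalues₀ k := by
  have hpad := Literature.Analysis.Matrix.ABvsBAEigenvalues.paddedEigenvalues_conjTranspose_mul_self (((diagonal fun i => if p i then Real.sqrt (K i) else (0 : ℝ)) * (CFC.sqrt V)))
  -- padded(XᵀX) = padded(XXᵀ); evaluate at `k < |n|`
  have h1 := congrFun hpad (k : ℕ)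
  rw [Literature.Analysis.Matrix.ABvsBAEigenvalues.paddedEigenvalues_of_lt _ k.isLt,
    Literature.Analysis.Matrix.ABvsBAEigenvalues.paddedEigenvalues_of_lt _ k.isLt] at h1
  -- h1 : λ↓_k(XᵀX) = λ↓_k(XXᵀ)
  rw [eigenvalues₀_congr (compressed_eq_xmat_mul hV K p) (isHermitian_compressed hV.isHermitian K p)
        (isHermitian_mul_conjTranspose_self _),
      eigenvalues₀_congr (mmat_eq_xmat_mul K p hK) (isHermitian_mmat (V := V) K p)
        (isHermitian_conjTranspose_mul_self _)]
  exact h1.symm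

end Root

/-! ### The dropped part `V^{1/2} K_⊥ V^{1/2}` and its quadratic form -/

section Dropped

variable {V : Matrix n n ℝ} (K : n → ℝ) (p : n → Prop) [DecidablePred p]

omit [Fintype n] [DecidableEq n] in
/-- `K_T + K_⊥ = K`. [folklore] -/
theorem keptWeight_add_droppedWeight : (fun i => if p i then K i else (0 : ℝ)) + (fun i => if p i then (0 : ℝ) else K i) = K := by
  funext i; by_cases h : p i <;> simp [h]

/-- `M = M_T + V^{1/2} K_⊥ V^{1/2}`. [folklore] -/
theorem mmat_top_eq_add :
    ((CFC.sqrt V) * diagonal K * (CFC.sqrt V)) = ((CFC.sqrt V) * diagonal (fun i => if p i then K i else (0 : ℝ)) * (CFC.sqrt V)) + (CFC.sqrt V) * diagonal ((fun i => if p i then (0 : ℝ) else K i)) * (CFC.sqrt V) := by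
  rw [← Matrix.add_mul, ← Matrix.mul_add, diagonal_add]
  have hsum : (diagonal fun i => (if p i then K i else (0 : ℝ)) + (if p i then (0 : ℝ) else K i)) = diagonal K := by
    congr 1
    funext i
    by_cases h : p i <;> simp [h]
  rw [hsum]

/-- The quadratic form of a diagonal matrix with non-negative entries is non-negative. [folklore] -/
theorem dotProduct_diagonal_mulVec_nonneg {w : n → ℝ} (hw0 : ∀ i, 0 ≤ w i) (u : n → ℝ) :
    0 ≤ u ⬝ᵥ (diagonal w *ᵥ u) := by
  have hform : u ⬝ᵥ (diagonal w *ᵥ u) = ∑ i, w i * (u i * u i) := by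
    simp only [dotProduct, mulVec_diagonal]
    exact Finset.sum_congr rfl fun i _ => by ring
  rw [hform]
  exact Finset.sum_nonneg fun i _ => mul_nonneg (hw0 i) (mul_self_nonneg (u i))

/-- The quadratic form of a diagonal matrix with entries `≤ κ` is at most `κ ‖u‖²`. [folklore] -/
theorem dotProduct_diagonal_mulVec_le {w : n → ℝ} {κ : ℝ} (hwκ : ∀ i, w i ≤ κ) (u : n → ℝ) :
    u ⬝ᵥ (diagonal w *ᵥ u) ≤ κ * (u ⬝ᵥ u) := by
  have hform : u ⬝ᵥ (diagonal w *ᵥ u) = ∑ i, w i * (u i * u i) := by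
    simp only [dotProduct, mulVec_diagonal]
    exact Finset.sum_congr rfl fun i _ => by ring
  have hnorm : κ * (u ⬝ᵥ u) = ∑ i, κ * (u i * u i) := by
    simp only [dotProduct, Finset.mul_sum]
  rw [hform, hnorm]
  exact Finset.sum_le_sum fun i _ => mul_le_mul_of_nonneg_right (hwκ i) (mul_self_nonneg (u i))

/-- The quadratic form of `V^{1/2} D V^{1/2}` is the form of `D` at `V^{1/2} u`. [folklore] -/
theorem dotProduct_root_diag_root (w : n → ℝ) (u : n → ℝ) :
    u ⬝ᵥ (((CFC.sqrt V) * diagonal w * (CFC.sqrt V)) *ᵥ u) =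
      ((CFC.sqrt V) *ᵥ u) ⬝ᵥ (diagonal w *ᵥ ((CFC.sqrt V) *ᵥ u)) := by
  rw [← mulVec_mulVec, ← mulVec_mulVec, dotProduct_mulVec, ← mulVec_transpose, root_transpose]

/-- The quadratic form of `V` is `‖V^{1/2} u‖²`. [folklore] -/
theorem dotProduct_mulVec_V_eq (hV : V.PosSemidef) (u : n → ℝ) : u ⬝ᵥ (V *ᵥ u) = ((CFC.sqrt V) *ᵥ u) ⬝ᵥ ((CFC.sqrt V) *ᵥ u) := by
  conv_lhs => rw [← root_mul_root hV]
  rw [← mulVec_mulVec, dotProduct_mulVec, ← mulVec_transpose, root_transpose]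

/-- `0 ≤ ⟨u, V^{1/2} K_⊥ V^{1/2} u⟩` for `K ≥ 0`. [folklore] -/
theorem dropped_form_nonneg (hK : ∀ i, 0 ≤ K i) (u : n → ℝ) :
    0 ≤ u ⬝ᵥ (((CFC.sqrt V) * diagonal ((fun i => if p i then (0 : ℝ) else K i)) * (CFC.sqrt V)) *ᵥ u) := by
  have hw0 : ∀ i, 0 ≤ (if p i then (0 : ℝ) else K i) := fun i => by
    by_cases h : p i <;> simp [h, hK i]
  rw [dotProduct_root_diag_root]
  exact dotProduct_diagonal_mulVec_nonneg hw0 _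

/-- `⟨u, V^{1/2} K_⊥ V^{1/2} u⟩ ≤ κ Ω ‖u‖²` when the dropped weights are `≤ κ`, `0 ≤ κ`, and `⟨u, V u⟩ ≤ Ω ‖u‖²`
(a bound on the top of the spectrum of `V`, e.g. the sup of the plaquette weight). [folklore] -/
theorem dropped_form_le {κ Ω : ℝ} (hV : V.PosSemidef) (hκ : ∀ i, ¬ p i → K i ≤ κ) (hκ0 : 0 ≤ κ)
    (hΩ : ∀ u : n → ℝ, u ⬝ᵥ (V *ᵥ u) ≤ Ω * (u ⬝ᵥ u)) (u : n → ℝ) :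
    u ⬝ᵥ (((CFC.sqrt V) * diagonal ((fun i => if p i then (0 : ℝ) else K i)) * (CFC.sqrt V)) *ᵥ u) ≤ κ * Ω * (u ⬝ᵥ u) := by
  have hwκ : ∀ i, (if p i then (0 : ℝ) else K i) ≤ κ := fun i => by
    by_cases h : p i
    · simp [h, hκ0]
    · simp [h, hκ i h]
  rw [dotProduct_root_diag_root]
  refine (dotProduct_diagonal_mulVec_le hwκ ((CFC.sqrt V) *ᵥ u)).trans ?_
  rw [← dotProduct_mulVec_V_eq hV, mul_assoc]
  exact mul_le_mul_of_nonneg_left (hΩ u) hκ0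

end Dropped

/-! ### The tail theorem -/

section Tail

variable {V : Matrix n n ℝ} (hV : V.PosSemidef) (K : n → ℝ) (p : n → Prop) [DecidablePred p]

/-- Bridge: the real inner product `⟪(toEuclideanLin A) x, x⟫` is the quadratic form `xᵀ A x`. [folklore] -/
theorem inner_toEuclideanLin_self (A : Matrix n n ℝ) (x : EuclideanSpace ℝ n) :
    ⟪Matrix.toEuclideanLin A x, x⟫_ℝ = WithLp.ofLp x ⬝ᵥ (A *ᵥ WithLp.ofLp x) := by
  rw [real_inner_comm, EuclideanSpace.inner_eq_star_dotProduct, star_trivial, Matrix.ofLp_toLpLin,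
    Matrix.toLin'_apply, dotProduct_comm]

omit [DecidableEq n] in
/-- `‖x‖² = xᵀ x` on `EuclideanSpace ℝ n`. [folklore] -/
theorem norm_sq_eq_dotProduct (x : EuclideanSpace ℝ n) : ‖x‖ ^ 2 = WithLp.ofLp x ⬝ᵥ WithLp.ofLp x := by
  rw [EuclideanSpace.real_norm_sq_eq]
  simp only [dotProduct, pow_two]

/-- **TAIL THEOREM, lower half**: `λ↓_k(S_T) ≤ λ↓_k(S)` for every `k`, every non-negative weight `K`, every
kept predicate `p` and every positive semidefinite `V`. [cite: HornJohnson2013, Thm 4.3.1] -/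
theorem eigenvalues₀_compressed_le (hK : ∀ i, 0 ≤ K i) (k : Fin (Fintype.card n)) :
    (isHermitian_compressed hV.isHermitian K p).eigenvalues₀ k ≤
      (isHermitian_full hV.isHermitian K).eigenvalues₀ k := by
  rw [eigenvalues₀_congr (full_eq_compressed V K) (isHermitian_full hV.isHermitian K)
        (isHermitian_compressed hV.isHermitian K _),
    eigenvalues₀_compressed_eq_mmat hV K p hK, eigenvalues₀_compressed_eq_mmat hV K _ hK]
  have hT := Matrix.isSymmetric_toEuclideanLin_iff.mpr (isHermitian_mmat (V := V) K p)
  have hS := Matrix.isSymmetric_toEuclideanLin_iff.mpr (isHermitian_mmat (V := V) K (fun _ => True))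
  have hc : ∀ x : EuclideanSpace ℝ n, -((0 : ℝ) * ‖x‖ ^ 2) ≤
      RCLike.re ⟪(Matrix.toEuclideanLin (((CFC.sqrt V) * diagonal K * (CFC.sqrt V))) -
        Matrix.toEuclideanLin (((CFC.sqrt V) * diagonal (fun i => if p i then K i else (0 : ℝ)) * (CFC.sqrt V)))) x, x⟫_ℝ := by
    intro x
    rw [zero_mul, neg_zero, ← map_sub, mmat_top_eq_add K p, add_sub_cancel_left, RCLike.re_to_real,
      inner_toEuclideanLin_self]
    exact dropped_form_nonneg K p hK _
  have h := Literature.Analysis.InnerProduct.eigenvalues_sub_le_eigenvalues_of_le_re_inner_sub hT hS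
    finrank_euclideanSpace hc k
  rw [sub_zero] at h
  exact h

/-- **TAIL THEOREM, upper half** (flow-ref FR-18 / flow-theory TAIL-A): if the dropped weights are at most `κ`
(`K i ≤ κ` off the kept set, `0 ≤ κ`) and the quadratic form of `V` is at most `Ω ‖u‖²`, then
`λ↓_k(S) ≤ λ↓_k(S_T) + κ · Ω` for every `k`. [cite: HornJohnson2013, Thm 1.3.22; Thm 4.3.1] -/
theorem eigenvalues₀_le_compressed_add {κ Ω : ℝ} (hK : ∀ i, 0 ≤ K i) (hκ : ∀ i, ¬ p i → K i ≤ κ)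
    (hκ0 : 0 ≤ κ) (hΩ : ∀ u : n → ℝ, u ⬝ᵥ (V *ᵥ u) ≤ Ω * (u ⬝ᵥ u)) (k : Fin (Fintype.card n)) :
    (isHermitian_full hV.isHermitian K).eigenvalues₀ k ≤
      (isHermitian_compressed hV.isHermitian K p).eigenvalues₀ k + κ * Ω := by
  rw [eigenvalues₀_congr (full_eq_compressed V K) (isHermitian_full hV.isHermitian K)
        (isHermitian_compressed hV.isHermitian K _),
    eigenvalues₀_compressed_eq_mmat hV K p hK, eigenvalues₀_compressed_eq_mmat hV K _ hK]
  have hT := Matrix.isSymmetric_toEuclideanLin_iff.mpr (isHermitian_mmat (V := V) K p)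
  have hS := Matrix.isSymmetric_toEuclideanLin_iff.mpr (isHermitian_mmat (V := V) K (fun _ => True))
  have hc : ∀ x : EuclideanSpace ℝ n,
      RCLike.re ⟪(Matrix.toEuclideanLin (((CFC.sqrt V) * diagonal K * (CFC.sqrt V))) -
        Matrix.toEuclideanLin (((CFC.sqrt V) * diagonal (fun i => if p i then K i else (0 : ℝ)) * (CFC.sqrt V)))) x, x⟫_ℝ ≤ κ * Ω * ‖x‖ ^ 2 := by
    intro x
    rw [← map_sub, mmat_top_eq_add K p, add_sub_cancel_left, RCLike.re_to_real, inner_toEuclideanLin_self,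
      norm_sq_eq_dotProduct]
    exact dropped_form_le K p hV hκ hκ0 hΩ _
  exact Literature.Analysis.InnerProduct.eigenvalues_le_eigenvalues_add_of_re_inner_sub_le hT hS
    finrank_euclideanSpace hc k

/-- The two halves together: `λ↓_k(S) ∈ [λ↓_k(S_T), λ↓_k(S_T) + κ Ω]` — the enclosure every lineage-B row adds to
its certified block eigenvalue. [cite: HornJohnson2013, Thm 1.3.22; Thm 4.3.1] -/
theorem eigenvalues₀_mem_Icc {κ Ω : ℝ} (hK : ∀ i, 0 ≤ K i) (hκ : ∀ i, ¬ p i → K i ≤ κ) (hκ0 : 0 ≤ κ)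
    (hΩ : ∀ u : n → ℝ, u ⬝ᵥ (V *ᵥ u) ≤ Ω * (u ⬝ᵥ u)) (k : Fin (Fintype.card n)) :
    (isHermitian_full hV.isHermitian K).eigenvalues₀ k ∈
      Set.Icc ((isHermitian_compressed hV.isHermitian K p).eigenvalues₀ k)
        ((isHermitian_compressed hV.isHermitian K p).eigenvalues₀ k + κ * Ω) :=
  ⟨eigenvalues₀_compressed_le hV K p hK k, eigenvalues₀_le_compressed_add hV K p hK hκ hκ0 hΩ k⟩

end Tail

end KWeightTail

end Summit.Ventures.YMGap.FlowData
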